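import Literature.Geometry.Riemannian.BaerHankeGluing
import HarnessLib

/-!
# Bär–Hanke: deformations of a positive scalar curvature metric near the boundary
# (mean-curvature increase, Prop. 28; umbilic `C`-normal form, Thm. 27)

Topic `Literature/Geometry/Riemannian` (namespace `Literature.Geometry.Riemannian`). This file
vendors TWO named facts from §3 "Deformations of the metric" of Bär–Hanke, *Boundary conditions
for scalar curvature* (arXiv:2012.09127; READ: arXiv text pp. 10–14, Def. 21, Remark 22,
Prop. 23, Prop. 26, Thm. 27, Prop. 28, Remark 29), in the vocabulary and with the clause shapes of
the sibling file `BaerHankeGluing.lean` (`BaerHankePscGluing`), of which they are the local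
deformation-theoretic input. No proof is within reach of the tree (flexibility lemma for open
partial differential relations [BH, Addendum 3.4], the estimates of Prop. 26).

**The source (§3).** `M` is a smooth manifold of dimension `n ≥ 2` with compact boundary `∂M`,
`g` a Riemannian metric, `g₀` the induced metric on `∂M`, `II_g` the second fundamental form of
`∂M` w.r.t. the INTERIOR unit normal, `H_g = (1/(n-1)) tr_{g₀}(II_g)`; `σ : M → ℝ` continuous,
`𝓡_{>σ}(M)` the metrics with `scal > σ`. Near `∂M`, by the generalized Gauss lemma,
`g = dt² + g_t` on `[0, ε) × ∂M ≅ U_ε^g(∂M)` (normal exponential map, `t` = distance to `∂M`),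
and `II_t = -½ ġ_t`. **Def. 21**: `g` is `C`-normal if `g_t = g₀ + t ġ₀ - C t² g₀ = g₀ - 2t II_g - C t² g₀`.
**Thm. 27** (master theorem, `K` = point): for `g ∈ 𝓡_{>σ}(M)` and a smooth symmetric
`(2,0)`-tensor `k` on `∂M` with `(1/(n-1)) tr_{g₀}(k) ≤ H_g` there is `C₀ > 0` such that for each
`C ≥ C₀` and each neighbourhood `𝒰` of `∂M` there is a continuous path `f : [0,1] → 𝓡_{>σ}(M)`
with `f(0) = g`, `f(1)` `C`-normal, `f(s)|_{∂M} = g|_{∂M}` (so `f(s)₀ = g₀`), `II_{f(1)} = k`,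
`f(s) = g` off `𝒰`. **Prop. 28**: for `g ∈ 𝓡_{>σ}(M)` and each neighbourhood `𝒰` of `∂M` there is
a continuous `f : [-1,1] → 𝓡_{>σ}(M)` with `f(0) = g`, `f(s)|_{∂M} = g|_{∂M}`, `II_{f(s)} > II_g` and
`H_{f(s)} > H_g` for `s > 0`, `f(s) = g` off `𝒰`; the proof gives explicitly
`II_{f(s)} = II_g + ½ s δ g₀`, `H_{f(s)} = H_g + ½ s δ` (a positive CONSTANT for `s > 0`).

**Dictionary with the tree** (as in `BaerHankeGluing.lean`): metrics are
`Literature.Geometry.Lorentzian.PseudoRiemannianMetric` on `TangentSpace (𝓡∂ (m+2))` of a compact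
smooth `(m+2)`-manifold with boundary `X` (`m + 2 ≥ 2` = the source's `n ≥ 2`), the boundary is a
`Literature.Topology.FourManifolds.BoundaryData` datum `bX` (model `𝓡 (m+1)`), `ν` is a smooth
OUTWARD unit normal along `bX.incl` (negative first half-space coordinate), the induced boundary
form is `pullbackBilin bX.incl g.val`, and the tree's `meanCurvature` is the trace of
`K_ν(v,w) = g(∇_v ν_out, w)` WITHOUT normalisation. SIGN/SCALE CHECK: `II_BH = -½ ġ_t =
-g(∇ ν_in, ·) = g(∇ ν_out, ·) = K_{ν_out}`, hence `H_tree = (m+1) · H_BH`; the unit ball has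
`H_BH = 1`, `H_tree = m + 1`. Consequently: (i) Prop. 28's constant increase `H_BH ↦ H_BH + ½sδ`
is `H_tree ↦ H_tree + δ'` with `δ' = (m+1) s δ / 2 > 0`; (ii) for the UMBILIC choice `k = μ · g₀`
(`μ : ∂M → ℝ` smooth) Thm. 27's hypothesis `(1/(n-1)) tr_{g₀}(k) = μ ≤ H_BH` reads
`(m+1) · μ ≤ H_tree`, and the `C`-normal form of `f(1)` is the warped product
`dt² + (1 - 2μ t - C t²) g₀` on `[0, ε₀) × ∂M`; reparametrising the closed normal collar
`t = ε s`, `s ∈ [0,1]`, `0 < ε < ε₀`, gives a collar `c : ∂M × [0,1] → X` in the sense of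
`Literature.Topology.FourManifolds.BoundaryData.Collar` (smooth embedding for the product model
`(𝓡 (m+1)).prod (𝓡∂ 1)`, bottom = `bX.incl`, open image of `{s < 1}` = `U_ε`) with
`c^* f(1) = ε² ds² + (1 - 2 μ (ε s) - C (ε s)²) g₀`.  Since `f(s)|_{∂M} = g|_{∂M}` (the full metric
along the boundary), the given `ν` stays an outward unit normal for the deformed metric.

* `BarHanke2023_prop28_meanCurvatureIncrease` — Prop. 28, `σ = 0`, `K` = point, `s = 1`: the mean
  curvature of a PSC metric can be raised by a positive constant keeping the boundary form, the
  unit normal and `scal > 0`;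
* `BarHanke2023_thm27_umbilicNormalForm` — Thm. 27 with `σ = 0`, `K` = point, umbilic `k = μ g₀`,
  end point `f(1)` only, read through Def. 21 on a closed normal collar: `∃ C₀ > 0, ∀ C ≥ C₀`, a PSC
  metric with the same boundary form which on some collar is `ε² ds² + (1 - 2μεs - C(εs)²) g₀`
  (for all sufficiently small `ε > 0`).

Both are special cases of the printed statements (point family, `σ = 0`, end points of the
deformation paths, no control away from the boundary recorded); neither is stronger. The Levi-Civita
connection is packaged as `∃ _ : g'.HasLeviCivita` (automatic for smooth metrics:
`PseudoRiemannianMetric.hasLeviCivita`), as in `BaerHankePscGluing`.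

## References
* [BarHanke2023] C. Bär, B. Hanke, Boundary conditions for scalar curvature, in *Perspectives in
  Scalar Curvature* vol. 2, World Scientific 2023, 325–377 — §3: Def. 21, Remark 22, Prop. 23,
  Prop. 26, Thm. 27, Prop. 28, Remark 29 of arXiv:2012.09127 (pp. 10–14). READ.
-/

noncomputable section

open scoped Manifold ContDiff
open Set Function

namespace Literature.Geometry.Riemannian

open Literature.Topology.FourManifolds Literature.Geometry.Lorentzian

/-- **Bär–Hanke 2023, Prop. 28 — the mean curvature of a PSC metric can be increased by a
positive constant, keeping the boundary metric** (named fact; point family, `σ = 0`, `s = 1`).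
Let `X` be a compact smooth `(m+2)`-manifold with boundary datum `bX`, `g` a Riemannian metric on
`X` with Levi-Civita connection and positive scalar curvature, `bX.incl` a spacelike immersion,
`ν` a smooth outward unit normal field along `bX.incl`. Then there are `δ > 0` and a Riemannian
metric `g'` (with Levi-Civita connection, `bX.incl` spacelike) of positive scalar curvature for
which `ν` is still a unit normal, with the same induced boundary form
`incl^* g' = incl^* g`, and whose (tree, outward, un-normalised) mean curvature is
`H_{g'}(z) = H_g(z) + δ` for every `z : ∂X`. Source: `f(s) = g - sδψ(t) g₀` near `∂M`,
`H_{f(s)} = H_g + ½ s δ` (BH normalisation; `H_tree = (m+1) H_BH`).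
[cite: BarHanke2023, §3 Prop. 28 (arXiv:2012.09127) and its proof] -/
def BarHanke2023_prop28_meanCurvatureIncrease : Prop :=
  ∀ (m : ℕ) (X : Type) [TopologicalSpace X] [T2Space X] [SecondCountableTopology X]
    [ChartedSpace (EuclideanHalfSpace (m + 2)) X] [IsManifold (𝓡∂ (m + 2)) ∞ X] [CompactSpace X]
    (bX : BoundaryData (𝓡∂ (m + 2)) X (𝓡 (m + 1)))
    (g : PseudoRiemannianMetric (𝓡∂ (m + 2)) ∞ (EuclideanSpace ℝ (Fin (m + 2)))
      (TangentSpace (𝓡∂ (m + 2)) : X → Type _)) [g.HasLeviCivita]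
    (hf : g.IsSpacelikeImmersion (𝓡 (m + 1)) bX.incl) (ν : NormalField (𝓡∂ (m + 2)) bX.incl),
    g.IsRiemannian → (∀ x, 0 < g.scalarCurvature x) → g.IsUnitNormal (𝓡 (m + 1)) bX.incl ν 1 →
    ContMDiff (𝓡 (m + 1)) (𝓡∂ (m + 2)).tangent ∞
      (fun z ↦ (Bundle.TotalSpace.mk' (EuclideanSpace ℝ (Fin (m + 2))) (bX.incl z) (ν z) :
        TangentBundle (𝓡∂ (m + 2)) X)) →
    (∀ z, (show EuclideanSpace ℝ (Fin (m + 2)) from ν z) 0 < 0) →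
    ∃ (δ : ℝ) (_ : 0 < δ)
      (g' : PseudoRiemannianMetric (𝓡∂ (m + 2)) ∞ (EuclideanSpace ℝ (Fin (m + 2)))
        (TangentSpace (𝓡∂ (m + 2)) : X → Type _)) (_ : g'.HasLeviCivita)
      (hf' : g'.IsSpacelikeImmersion (𝓡 (m + 1)) bX.incl),
      g'.IsRiemannian ∧ (∀ x, 0 < g'.scalarCurvature x) ∧
      g'.IsUnitNormal (𝓡 (m + 1)) bX.incl ν 1 ∧
      (∀ z, pullbackBilin (I := 𝓡∂ (m + 2)) (I' := 𝓡 (m + 1)) bX.incl g'.val z =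
        pullbackBilin (I := 𝓡∂ (m + 2)) (I' := 𝓡 (m + 1)) bX.incl g.val z) ∧
      ∀ z, g'.meanCurvature bX.incl PseudoRiemannianMetric.contMDiff_pullbackBilin_holds hf' ν z =
        g.meanCurvature bX.incl PseudoRiemannianMetric.contMDiff_pullbackBilin_holds hf ν z + δ

/-- **Bär–Hanke 2023, Thm. 27 (master deformation theorem), umbilic case, read through Def. 21 —
the umbilic `C`-normal form** (named fact; point family, `σ = 0`, end point of the path).
Let `X` be a compact smooth `(m+2)`-manifold with boundary datum `bX`, `g` a Riemannian PSC metric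
with Levi-Civita connection, `bX.incl` spacelike, `ν` a smooth outward unit normal, and
`μ : ∂X → ℝ` smooth with `(m+1) · μ(z) ≤ H_g(z)` (tree mean curvature; = the source's
`(1/(n-1)) tr_{g₀}(k) ≤ H_g` for `k = μ g₀`). Then there is `C₀ > 0` such that for every `C ≥ C₀`
there are a Riemannian PSC metric `ĝ` on `X` (with Levi-Civita connection) with the same induced
boundary form `incl^* ĝ = incl^* g` and an `ε₀ > 0` such that for every `0 < ε ≤ ε₀` some collar
`c : ∂X × [0,1] → X` of `bX` (`BoundaryData.Collar`: smooth embedding, bottom `= bX.incl`, open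
image of `{s < 1}`) pulls `ĝ` back to the warped product
`ε² ds² + (1 - 2 μ(z) (ε s) - C (ε s)²) · (incl^* g)_z`, i.e. for tangent vectors
`V = (V.1, V.2)`, `W` of the product model `(𝓡 (m+1)).prod (𝓡∂ 1)` at `p = (z, s)`:
`(c^* ĝ)_p(V, W) = ε² V.2₀ W.2₀ + (1 - 2 μ(z) ε s - C ε² s²) (incl^* g)_z(V.1, W.1)`.
(Source: `f(1)` is `C`-normal with `f(1)₀ = g₀`, `II_{f(1)} = k = μ g₀`, so by Def. 21
`f(1) = dt² + (1 - 2μt - Ct²) g₀` on the normal collar `[0, ε₀') × ∂M`; reparametrise `t = ε s`.)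
[cite: BarHanke2023, §3 Thm. 27 with Def. 21 and Remark 22 (arXiv:2012.09127)] -/
def BarHanke2023_thm27_umbilicNormalForm : Prop :=
  ∀ (m : ℕ) (X : Type) [TopologicalSpace X] [T2Space X] [SecondCountableTopology X]
    [ChartedSpace (EuclideanHalfSpace (m + 2)) X] [IsManifold (𝓡∂ (m + 2)) ∞ X] [CompactSpace X]
    (bX : BoundaryData (𝓡∂ (m + 2)) X (𝓡 (m + 1)))
    (g : PseudoRiemannianMetric (𝓡∂ (m + 2)) ∞ (EuclideanSpace ℝ (Fin (m + 2)))
      (TangentSpace (𝓡∂ (m + 2)) : X → Type _)) [g.HasLeviCivita]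
    (hf : g.IsSpacelikeImmersion (𝓡 (m + 1)) bX.incl) (ν : NormalField (𝓡∂ (m + 2)) bX.incl)
    (μ : bX.carrier → ℝ),
    g.IsRiemannian → (∀ x, 0 < g.scalarCurvature x) → g.IsUnitNormal (𝓡 (m + 1)) bX.incl ν 1 →
    ContMDiff (𝓡 (m + 1)) (𝓡∂ (m + 2)).tangent ∞
      (fun z ↦ (Bundle.TotalSpace.mk' (EuclideanSpace ℝ (Fin (m + 2))) (bX.incl z) (ν z) :
        TangentBundle (𝓡∂ (m + 2)) X)) →
    (∀ z, (show EuclideanSpace ℝ (Fin (m + 2)) from ν z) 0 < 0) →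
    ContMDiff (𝓡 (m + 1)) 𝓘(ℝ, ℝ) ∞ μ →
    (∀ z, (m + 1 : ℝ) * μ z ≤
      g.meanCurvature bX.incl PseudoRiemannianMetric.contMDiff_pullbackBilin_holds hf ν z) →
    ∃ (C₀ : ℝ), 0 < C₀ ∧ ∀ (C : ℝ), C₀ ≤ C →
    ∃ (ĝ : PseudoRiemannianMetric (𝓡∂ (m + 2)) ∞ (EuclideanSpace ℝ (Fin (m + 2)))
        (TangentSpace (𝓡∂ (m + 2)) : X → Type _)) (_ : ĝ.HasLeviCivita) (ε₀ : ℝ),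
      ĝ.IsRiemannian ∧ (∀ x, 0 < ĝ.scalarCurvature x) ∧
      (∀ z, pullbackBilin (I := 𝓡∂ (m + 2)) (I' := 𝓡 (m + 1)) bX.incl ĝ.val z =
        pullbackBilin (I := 𝓡∂ (m + 2)) (I' := 𝓡 (m + 1)) bX.incl g.val z) ∧
      0 < ε₀ ∧ ∀ (ε : ℝ), 0 < ε → ε ≤ ε₀ → ∃ c : bX.Collar,
        ∀ (p : bX.carrier × Set.Icc (0 : ℝ) 1)
          (V W : TangentSpace ((𝓡 (m + 1)).prod (𝓡∂ 1)) p),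
          pullbackBilin (I := 𝓡∂ (m + 2)) (I' := (𝓡 (m + 1)).prod (𝓡∂ 1)) c ĝ.val p V W =
            ε ^ 2 * ((show EuclideanSpace ℝ (Fin 1) from V.2) 0 *
              (show EuclideanSpace ℝ (Fin 1) from W.2) 0) +
            (1 - 2 * μ p.1 * (ε * (p.2 : ℝ)) - C * (ε * (p.2 : ℝ)) ^ 2) *
              pullbackBilin (I := 𝓡∂ (m + 2)) (I' := 𝓡 (m + 1)) bX.incl g.val p.1 V.1 W.1

end Literature.Geometry.Riemannian
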